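import Summits.BirchSwinnertonDyer.BirchSwinnertonDyer.Theorems.TeichmullerTwistDescentManinUnitFromKatoTwistInputs
import Summits.BirchSwinnertonDyer.BirchSwinnertonDyer.Theorems.EdixhovenFibreFiveSevenLTwistTransfer
import HarnessLib

/-!
# Route `TeichmullerTwistDescent`: PSMU (stmt-BirchSwinnertonDyer-22638), SCMU57 (22639), CORNER (23883), LOW (23884)
# — and Manin's `p`-part at every lattice-optimal datum — GRANTED modularity, F″ and the TRANSFER WITNESS `hW″`:
# the IHARA-FREE twin of `TeichmullerTwistDescentCellsOfKatoIhara` (`--supports`)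

Cell `pub/bsd-wall` (D-0145 lines route-BirchSwinnertonDyer-TeichmullerTwistDescent / -EdixhovenFibreFiveSeven), seat
`bsd-line-edix-p2` (prover, g3). THEOREMS ONLY (no definition, no named fact, no `sorry`); every theorem is
`proof.conditional` (cite-only `hnf`, `hK`; `hW″` an elementary hypothesis, being proved by the cell); nothing is
closed; BSD is not proved by this.

Since 2026-08-28T01:37Z the tree holds TWO roads to the lattice inclusion L-TWIST `Λ(f) ⊆ s·Λ(f ⊗ χ_q) + p·Λ(f)`:
(A) `LTwist.lTwist_of_iharaSq_of_witness` — the THREE-COPY IHARA LEMMA (cite-only `diamondRibet1997_iharaLemma_sq`)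
+ the Chebotarev non-Eisenstein witness, at EVERY auxiliary prime `q ∤ 2pN`; consumed by ttd-p2's
`TeichmullerTwistDescentCellsOfKatoIhara`; and (A′) `LTwistTransfer.lTwist_of_transfer` (seat edix-p3, p594163; the
transfer of cycles, NO Ihara lemma) at the auxiliary primes `q` with `p ∤ (q − 1)((q + 1)² − a_q²)`. Road (A′) cannot
be fed to ttd-p2's `…_of_kato_of_periodTwist` closers, whose L-TWIST binder ranges over ALL `q`; but those closers
(`not_dvd_c_of_kato_of_periodTwist`, p58xxxx) USE L-TWIST at ONE auxiliary prime only — Dirichlet's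
`exists_auxPrime` on the Kosters–Pannekoek branch `p ∈ {5, 7}`, `W(ℚ_p)[p] ≠ 0`. This file re-runs that proof with
the auxiliary prime taken from the TRANSFER WITNESS instead:

* `not_dvd_c_of_kato_of_transferWitness` — for `W/ℚ` globally minimal, additive at `p ≥ 5` with `E[p]` irreducible
  and `D` a LATTICE-OPTIMAL datum at any level: `p ∤ c(D)`, GRANTED `exists_isNewformOf`, F″ and
  **`hW″ := ∀ p V₀, (p = 5 ∨ p = 7) → Addv V₀ p → Irr V₀ p → ∃ q prime, q ≠ 2, q ≠ p, q ∤ N(V₀),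
  ¬IsSquare (q* : ZMod p), ¬ p ∣ (q − 1)((q + 1)² − a_q(V₀)²)`** (VERBATIM the binder of edix-p3's
  `LTwistTransfer.twistDegreeStepFiveSeven_of_kato_of_transferWitness`, p594464). Proof: `p > 7` — the full
  tame-twist lever (`not_dvd_c_of_tameTwistL`, no twist at all); `p ∈ {5,7}`, `W(ℚ_p)[p] = 0` —
  `cell57_of_kato57_of_noPTorsion`; `p ∈ {5,7}` with a `ℚ_p`-rational point of order `p` — the witness prime `q`, a
  minimal model of `W ⊗ χ_{q*}` (`exists_minimal_twist_pStar`), ADDV-UNIT-TWIST (`addv_of_model_twist_auxPrime`),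
  TORS-TWIST (`torsTwist57_input`), L-TWIST at `q` by the transfer (`lTwist_of_transfer`), and the repair
  `not_dvd_optimal_c_of_kato_of_unitTwist`.
* `principalSeriesOptimalManinUnit_of_kato_of_transferWitness` (PSMU 22638),
  `supercuspidalOptimalManinUnitFiveSeven_of_kato_of_transferWitness` (SCMU57 22639),
  `kummerCornerTorsionOptimalManinUnit_of_kato_of_transferWitness` (CORNER 23883),
  `supersingularTorsionOptimalManinUnitFive_of_kato_of_transferWitness` (LOW 23884) — the four Manin decls of
  route TeichmullerTwistDescent BY NAME from {`exists_isNewformOf`, F″, hW″}.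

HONEST STATUS (numbers): cite-only inputs = 1 (F″ = `kato_neron_isIntegral_twistedSymbolSum_of_additive_five_le`, XL,
referee-flagged) + modularity (`exists_isNewformOf`) + the transfer witness `hW″` (elementary: Chebotarev in
`ℚ(E[4p])` + irreducible subgroups of `GL₂(𝔽_p)`, `p ∈ {5,7}`; seats manin-p1 g7 / edix-p3 g3 on it). No Ihara lemma,
no non-Eisenstein witness in the cone of these four items along this road. BSD is not proved by this.
[cite: Kato2004Asterisque, (8.1.3) (p. 180), Thm. 9.7 (p. 189)] [cite: KostersPannekoek2017, Thm. 1 and Cor. 2]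
[cite: Stevens1989, Lemma (5.2) p. 96, Lemma (5.4) p. 97] [cite: Ribet1990, §3] [cite: BCDTJAMS2001, Thm. A]
-/

set_option autoImplicit false
-- single-conjunct summit: `Summit.BirchSwinnertonDyer.BirchSwinnertonDyer.…` repeats the name by design
set_option linter.dupNamespace false

noncomputable section

open scoped Classical MatrixGroups

open WeierstrassCurve IsDedekindDomain Rat.HeightOneSpectrum NumberField
  Literature.NumberTheory.EllipticCurves Literature.NumberTheory.EllipticCurves.ModularForms
  Literature.NumberTheory.EllipticCurves.Rank1Residual Literature.NumberTheory.DiophantineGeometry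
  Summit.BirchSwinnertonDyer.Rank1Residual Summit.BirchSwinnertonDyer.Rank1Residual.Additive
  Summit.BirchSwinnertonDyer.BirchSwinnertonDyer.Theses.TeichmullerTwistDescent
  Summit.BirchSwinnertonDyer.BirchSwinnertonDyer.Theorems CongruenceSubgroup

namespace Summit.BirchSwinnertonDyer.BirchSwinnertonDyer.Theorems.TeichmullerTwistDescent

/-! ### §1 The master statement with the transfer witness in place of Dirichlet's auxiliary prime -/

/-- **Manin's `p`-part at EVERY lattice-optimal datum, GRANTED modularity, F″ and the TRANSFER WITNESS** (no Ihara
lemma). For `W/ℚ` globally minimal, additive at `p ≥ 5` with `E[p]` irreducible and `D` lattice-optimal at any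
level: `p ∤ c(D)`. The proof of `not_dvd_c_of_kato_of_periodTwist` (ttd-p2) with, on the Kosters–Pannekoek branch
(`p ∈ {5,7}`, a `ℚ_p`-rational point of order `p`), the auxiliary prime supplied by `hW` — `q > ` nothing, `q ∤ N(W)`,
`q*` a non-square mod `p`, `p ∤ (q−1)((q+1)² − a_q(W)²)` — and L-TWIST at that `q` by the transfer of cycles
(`LTwistTransfer.lTwist_of_transfer`, Road A′). CONDITIONAL (`hnf`, `hK` cite-only; `hW` elementary, unproved
here); BSD is not proved by this. [cite: Kato2004Asterisque, (8.1.3) (p. 180), Thm. 9.7 (p. 189)]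
[cite: KostersPannekoek2017, Thm. 1 and Cor. 2] [cite: Stevens1989, Lemma (5.4) p. 97] [cite: Ribet1990, §3] -/
theorem not_dvd_c_of_kato_of_transferWitness (hnf : exists_isNewformOf)
    (hK : kato_neron_isIntegral_twistedSymbolSum_of_additive_five_le)
    (hW : ∀ (p : ℕ) [Fact p.Prime] (V₀ : WeierstrassCurve ℚ) [V₀.IsElliptic] [V₀.IsGloballyMinimal],
      (p = 5 ∨ p = 7) → Addv V₀ p → Irr V₀ p →
      ∃ q : ℕ, q.Prime ∧ q ≠ 2 ∧ q ≠ p ∧ ¬ q ∣ V₀.conductorNorm ℤ ∧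
        ¬ IsSquare ((((-1 : ℤ) ^ (q / 2) * q : ℤ)) : ZMod p) ∧
        ¬ (p : ℤ) ∣ ((q : ℤ) - 1) * (((q : ℤ) + 1) ^ 2 - V₀.LFunction q ^ 2))
    (W : WeierstrassCurve ℚ) [W.IsElliptic] [W.IsGloballyMinimal] (p : ℕ) [hp : Fact p.Prime]
    {N : ℕ} [NeZero N] (D : ModularParametrizationData W N)
    (hp5 : 5 ≤ p) (hadd : Addv W p) (hirr : Irr W p)
    (hlat : ∀ z ∈ D.L.lattice, ∃ w ∈ periodLattice D.f, z = D.c * w) :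
    ¬ (p : ℤ) ∣ D.c := by
  have hpP : p.Prime := hp.out
  have hN : N = W.conductorNorm ℤ :=
    IsNewformOf.level_eq_conductorNorm_of_exists_isNewformOf hnf D.isNewformOf
  subst hN
  have hpN : p ^ 2 ∣ W.conductorNorm ℤ := sq_dvd_conductorNorm_of_not_good_of_not_mult hadd
  have ha := lFunction_eq_one_or_neg_one_of_exactly_dvd_conductorNorm W
  rcases Nat.lt_or_ge 7 p with h7 | h7
  · exact ManinFrameResidueProperRTameTwist.not_dvd_c_of_tameTwistL
      (Cruxes.StarredOptimalManinUnitFiveSeven.KatoLever.kato_neron_of_five_le hK) W D hlat h7 hadd hirr hpN ha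
  · have hp57 : p = 5 ∨ p = 7 := by
      interval_cases p <;>
        first | exact Or.inl rfl | exact Or.inr rfl | exact absurd hpP (by decide)
    by_cases hPT : ∀ P : (W.baseChange ℚ_[p]).toAffine.Point, p • P = 0 → P = 0
    · exact cell57_of_kato57_of_noPTorsion hK W p D hp57 hadd hirr hPT hlat
    · push Not at hPT
      obtain ⟨P, hP, hP0⟩ := hPT
      -- the auxiliary prime from the TRANSFER WITNESS
      obtain ⟨q, hq, hq2, hqp, hqN', hnsq, hu⟩ := hW p W hp57 hadd hirr
      haveI : Fact q.Prime := ⟨hq⟩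
      have hqsq : ¬ q ^ 2 ∣ W.conductorNorm ℤ := fun h ↦ hqN' ((dvd_pow_self q two_ne_zero).trans h)
      have hgm : W.HasGoodReductionAtPrime q ∨ W.HasMultiplicativeReductionAtPrime q :=
        hasGoodReductionAtPrime_or_hasMultiplicativeReductionAtPrime_of_not_sq_dvd_conductorNorm (V := W) hqsq
      obtain ⟨Vχ, hEχ, hMχ, v, hv⟩ := exists_minimal_twist_pStar q W
      haveI := hEχ
      haveI := hMχ
      haveI : NeZero (Vχ.conductorNorm ℤ) := ⟨(Vχ.conductorNorm_pos_holds).ne'⟩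
      have hv' : v • W.quadraticTwist (((-1 : ℤ) ^ (q / 2) * q : ℤ) : ℚ) = Vχ := by
        rw [(pStar_intCast q).1]; exact hv
      obtain ⟨s, hs2⟩ := IsAlgClosed.exists_pow_nat_eq ((((-1 : ℤ) ^ (q / 2) * q : ℤ)) : ℂ) two_pos
      have haddχ : Addv Vχ p :=
        AddvUnitTwist.addv_of_model_twist_auxPrime (by omega) hq hqp hadd ⟨v, hv'⟩
      -- TORS-TWIST (tree theorem)
      have hPTχ : ∀ (W' : WeierstrassCurve ℚ) [W'.IsElliptic] [W'.IsGloballyMinimal], IsIsogenous Vχ W' →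
          ∀ Q : (W'.baseChange ℚ_[p]).toAffine.Point, p • Q = 0 → Q = 0 :=
        fun W' _ _ hiso Q hQ ↦ TorsTwist.torsTwist57_input p q W hp57 hadd hirr hqp hnsq
          ⟨W, ‹_›, ‹_›, P, isIsogenous_self W, hP0, hP⟩ Vχ v hv' W' hiso Q hQ
      -- L-TWIST at `q` by the TRANSFER (Road A′, no Ihara lemma)
      have hL : ∀ (N' : ℕ) [NeZero N'] (g : CuspForm (Gamma0 N') 2), IsNewformOf Vχ g →
          ∀ z ∈ periodLattice D.f, ∃ w ∈ periodLattice g, ∃ y ∈ periodLattice D.f,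
            z = s * w + (p : ℂ) * y :=
        fun N' _ g hg ↦ LTwistTransfer.lTwist_of_transfer W D hq2 hqp hqN' hu Vχ v hv' s hs2 g hg
      exact TwistDegreeStepFiveSevenUnitTwist.not_dvd_optimal_c_of_kato_of_unitTwist hK hnf hp57 W hirr D
        hlat hq2 hgm Vχ v hv' haddχ hPTχ s hs2 hL

/-! ### §2 The four Manin decls of route TeichmullerTwistDescent BY NAME, Ihara-free -/

/-- **PSMU (stmt-BirchSwinnertonDyer-22638) GRANTED modularity, F″ and the transfer witness** (no Ihara lemma).
CONDITIONAL; the item is not closed by this; BSD is not proved by this.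
[cite: Kato2004Asterisque, Thm. 9.7 (p. 189)] [cite: Ribet1990, §3] -/
theorem principalSeriesOptimalManinUnit_of_kato_of_transferWitness (hnf : exists_isNewformOf)
    (hK : kato_neron_isIntegral_twistedSymbolSum_of_additive_five_le)
    (hW : ∀ (p : ℕ) [Fact p.Prime] (V₀ : WeierstrassCurve ℚ) [V₀.IsElliptic] [V₀.IsGloballyMinimal],
      (p = 5 ∨ p = 7) → Addv V₀ p → Irr V₀ p →
      ∃ q : ℕ, q.Prime ∧ q ≠ 2 ∧ q ≠ p ∧ ¬ q ∣ V₀.conductorNorm ℤ ∧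
        ¬ IsSquare ((((-1 : ℤ) ^ (q / 2) * q : ℤ)) : ZMod p) ∧
        ¬ (p : ℤ) ∣ ((q : ℤ) - 1) * (((q : ℤ) + 1) ^ 2 - V₀.LFunction q ^ 2)) :
    PrincipalSeriesOptimalManinUnit := by
  intro W _ _ p _ N _ D hp5 hadd hirr _ _ hlat
  exact not_dvd_c_of_kato_of_transferWitness hnf hK hW W p D hp5 hadd hirr hlat

/-- **SCMU57 (stmt-BirchSwinnertonDyer-22639) GRANTED modularity, F″ and the transfer witness** (no Ihara lemma).
CONDITIONAL; the item is not closed by this; BSD is not proved by this.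
[cite: Kato2004Asterisque, Thm. 9.7 (p. 189)] [cite: Ribet1990, §3] -/
theorem supercuspidalOptimalManinUnitFiveSeven_of_kato_of_transferWitness (hnf : exists_isNewformOf)
    (hK : kato_neron_isIntegral_twistedSymbolSum_of_additive_five_le)
    (hW : ∀ (p : ℕ) [Fact p.Prime] (V₀ : WeierstrassCurve ℚ) [V₀.IsElliptic] [V₀.IsGloballyMinimal],
      (p = 5 ∨ p = 7) → Addv V₀ p → Irr V₀ p →
      ∃ q : ℕ, q.Prime ∧ q ≠ 2 ∧ q ≠ p ∧ ¬ q ∣ V₀.conductorNorm ℤ ∧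
        ¬ IsSquare ((((-1 : ℤ) ^ (q / 2) * q : ℤ)) : ZMod p) ∧
        ¬ (p : ℤ) ∣ ((q : ℤ) - 1) * (((q : ℤ) + 1) ^ 2 - V₀.LFunction q ^ 2)) :
    SupercuspidalOptimalManinUnitFiveSeven := by
  intro W _ _ p _ N _ D hp57 hadd hirr _ _ hlat
  exact not_dvd_c_of_kato_of_transferWitness hnf hK hW W p D (by rcases hp57 with rfl | rfl <;> omega)
    hadd hirr hlat

/-- **CORNER (stmt-BirchSwinnertonDyer-23883) GRANTED modularity, F″ and the transfer witness** (no Ihara lemma) —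
the Kosters–Pannekoek corner III@5 / II@7 with a `ℚ_p`-rational point of order `p` is reached by Kato's Euler
system + the auxiliary unit twist + the TRANSFER of cycles. CONDITIONAL; the item is not closed by this; BSD is
not proved by this. [cite: Kato2004Asterisque, Thm. 9.7 (p. 189)] [cite: KostersPannekoek2017, Cor. 2]
[cite: Ribet1990, §3] -/
theorem kummerCornerTorsionOptimalManinUnit_of_kato_of_transferWitness (hnf : exists_isNewformOf)
    (hK : kato_neron_isIntegral_twistedSymbolSum_of_additive_five_le)
    (hW : ∀ (p : ℕ) [Fact p.Prime] (V₀ : WeierstrassCurve ℚ) [V₀.IsElliptic] [V₀.IsGloballyMinimal],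
      (p = 5 ∨ p = 7) → Addv V₀ p → Irr V₀ p →
      ∃ q : ℕ, q.Prime ∧ q ≠ 2 ∧ q ≠ p ∧ ¬ q ∣ V₀.conductorNorm ℤ ∧
        ¬ IsSquare ((((-1 : ℤ) ^ (q / 2) * q : ℤ)) : ZMod p) ∧
        ¬ (p : ℤ) ∣ ((q : ℤ) - 1) * (((q : ℤ) + 1) ^ 2 - V₀.LFunction q ^ 2)) :
    KummerCornerTorsionOptimalManinUnit := by
  intro W _ _ p _ _ D hp hadd hirr _ _ hlat
  exact not_dvd_c_of_kato_of_transferWitness hnf hK hW W p D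
    (by rcases hp with ⟨rfl, -⟩ | ⟨rfl, -⟩ <;> norm_num) hadd hirr hlat

/-- **LOW (stmt-BirchSwinnertonDyer-23884) GRANTED modularity, F″ and the transfer witness** (no Ihara lemma).
CONDITIONAL; the item is not closed by this; BSD is not proved by this.
[cite: Kato2004Asterisque, Thm. 9.7 (p. 189)] [cite: KostersPannekoek2017, Cor. 2] [cite: Ribet1990, §3] -/
theorem supersingularTorsionOptimalManinUnitFive_of_kato_of_transferWitness (hnf : exists_isNewformOf)
    (hK : kato_neron_isIntegral_twistedSymbolSum_of_additive_five_le)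
    (hW : ∀ (p : ℕ) [Fact p.Prime] (V₀ : WeierstrassCurve ℚ) [V₀.IsElliptic] [V₀.IsGloballyMinimal],
      (p = 5 ∨ p = 7) → Addv V₀ p → Irr V₀ p →
      ∃ q : ℕ, q.Prime ∧ q ≠ 2 ∧ q ≠ p ∧ ¬ q ∣ V₀.conductorNorm ℤ ∧
        ¬ IsSquare ((((-1 : ℤ) ^ (q / 2) * q : ℤ)) : ZMod p) ∧
        ¬ (p : ℤ) ∣ ((q : ℤ) - 1) * (((q : ℤ) + 1) ^ 2 - V₀.LFunction q ^ 2)) :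
    SupersingularTorsionOptimalManinUnitFive := by
  intro W _ _ p _ _ D hp hadd hirr _ _ hlat
  exact not_dvd_c_of_kato_of_transferWitness hnf hK hW W p D
    (by rcases hp with ⟨rfl, -⟩ | ⟨rfl, -⟩ <;> norm_num) hadd hirr hlat

end Summit.BirchSwinnertonDyer.BirchSwinnertonDyer.Theorems.TeichmullerTwistDescent

end
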